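import Summits.ABC.ABC.Theorems.DefiniteXiDefiniteRTControlPrimeOfTakahashi
import Literature.NumberTheory.EllipticCurves.TakahashiDegreeFormulaCoprimeProofs
import Literature.NumberTheory.EllipticCurves.TakahashiDegreeFormulaFromDictionary
import HarnessLib

/-!
# STUB-IDEAS companion — `stub_takahashi` · ideator k1 · generation 25 (FAMILY 1: recognise & import)

Crux `stmt-ABC-11338` (`Summit.ABC.ABC.Theses.DefiniteXi.DefiniteRTControlPrime`); registered stub
`theorem stub_takahashi : takahashi2001_thm_2_3_of_coprime` (the reviewed NAMED FACT, Takahashi 2001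
Thm. 2.3 at `r ∥ N`).  Elaboration sanity (no `sorry`, nothing here is a stub proof) of the helper
statements H1–H3 of the gen-25 sheet: the **coprime twins** of the tree's EXISTING reviewed fact pair
`takahashi2001_brandtEigenLattice_rank_one` / `takahashi2001_characterGroupDictionary`
(`TakahashiDegreeFormulaFromDictionary.lean`, square-free `M r`), typed as `def … : Prop` so that a
fact typer can file them beside (or above) the square-free pair, and the assembly H3 (= the tree's
`takahashi2001_thm_2_3_of_coprime_of_brandtDictionary_one'`), plus the crux BY NAME over the landed
closer.  Port of the sibling shape `Summits/BirchSwinnertonDyer/…/Lines/partnerdescent.lean` v14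
(registered 2026-08-31: every stub an ITEM or a cite-only print NAME, `stub_printFactsAll`).
[cite: Takahashi2001, §2 p. 78, Thm. 2.3 (p. 79), remark p. 80] [cite: ConradStein2001, §2.1, §7.1]
[cite: Ribet1990, §3] [cite: Pizer1980, Thm. 2.28]
-/

set_option linter.dupNamespace false

noncomputable section

namespace Summit.ABC.ABC.Cruxes.DefiniteRTControlPrime.StubIdeas1G25

open scoped BigOperators
open Literature.NumberTheory.EllipticCurves Literature.NumberTheory.EllipticCurves.ModularForms
open Literature.NumberTheory.Automorphic

/-- **H2** (named-fact candidate, coprime twin of `takahashi2001_brandtEigenLattice_rank_one`):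
multiplicity one for the Brandt eigen-lattice of `W` at coprime level `(M, r)`, `r` prime,
`N(W) = M r`.  PRINT: Takahashi 2001 p. 78; Pizer 1980 Thm. 2.28 at every `M` prime to `r`.
Tree: PROVED at square-free `M r` (`takahashi2001_brandtEigenLattice_rank_one_holds`); at general
`M` reduced (k1-g21) to Pizer's trace identity = named fact `HeckeTraceFormulaGL2Level N 1 2` at
`N ∈ {M r, M}` + Eichler's Brandt trace formula. [cite: Takahashi2001, §2 p. 78] [cite: Pizer1980, Thm. 2.28] -/
def takahashi2001_brandtEigenLattice_rank_one_of_coprime : Prop :=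
  ∀ (W : WeierstrassCurve ℚ) [W.IsElliptic] (M r : ℕ) [NeZero (M * r)],
    r.Prime → M.Coprime r → W.conductorNorm ℤ = M * r →
    ∀ (_P : ModularParametrizationData W (M * r)) (S : Brandt.XiSetup M r)
      [Fintype (Brandt.ClassSet S.O)],
      Module.finrank ℤ
        (Brandt.eigenLattice (M * r) (Brandt.matrix S.O) (fun n => W.LFunction n)) = 1

/-- **H1** (named-fact candidate, coprime twin of `takahashi2001_characterGroupDictionary`): the
character-group dictionary at `r ∥ N` — `X_r(J₀(Mr))` with Grothendieck's pairing is the weighted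
Brandt lattice (Ribet 1990 §3 / Kohel Thm. 4.3 at `r ∤ M`, `M` ARBITRARY), `u_E(x, x) = ord_r Δ_min`
(SGA 7 IX 11.5), `π_* π^* = δ`, `π_*` onto and `π^* X_E` in the eigen-line for the optimal `π`
(Conrad–Stein 2001 §2.1, §7.1, `N = M p`, `M` arbitrary; Takahashi remark p. 80).  Body VERBATIM
`Lines/TakahashiLeaves.lean` stub 2.  XL to prove in tree (no Néron models); cite-only in print.
[cite: ConradStein2001, §2.1, §7.1] [cite: Ribet1990, §3] [cite: Takahashi2001, Prop. 1.1, p. 80] -/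
def takahashi2001_characterGroupDictionary_of_coprime : Prop :=
  ∀ (W : WeierstrassCurve ℚ) [W.IsElliptic] (M r : ℕ) [NeZero (M * r)],
    r.Prime → M.Coprime r → W.conductorNorm ℤ = M * r →
    ∀ P : ModularParametrizationData W (M * r),
      (∀ (W' : WeierstrassCurve ℚ) [W'.IsElliptic], W'.conductorNorm ℤ = M * r →
          ∀ P' : ModularParametrizationData W' (M * r),
          P'.f = P.f → P.modularDegree ≤ P'.modularDegree) →
      ∀ (S : Brandt.XiSetup M r) [Fintype (Brandt.ClassSet S.O)],
        ∃ (X : Submodule ℤ (Brandt.ClassSet S.O → ℤ)) (pb : ℤ →ₗ[ℤ] X) (pf : X →ₗ[ℤ] ℤ),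
          (∀ (a : ℤ) (y : X),
              ∑ i, (Brandt.weight S.O i : ℤ) * (pb a : Brandt.ClassSet S.O → ℤ) i *
                  (y : Brandt.ClassSet S.O → ℤ) i =
                ((W.minimalDiscriminantNorm ℤ).factorization r : ℤ) * a * pf y) ∧
          (∀ a : ℤ, pf (pb a) = (P.modularDegree : ℤ) * a) ∧
          Function.Surjective pf ∧
          (∀ (m : ℤ) (v : Brandt.ClassSet S.O → ℤ), m ≠ 0 → m • v ∈ X → v ∈ X) ∧
          (pb 1 : Brandt.ClassSet S.O → ℤ) ∈
            Brandt.eigenLattice (M * r) (Brandt.matrix S.O) (fun n => W.LFunction n)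

/-- **H3** (XS, PROVED): the stub statement from H2 and H1 — the `r ∥ N` twin of the tree's
`takahashi2001_thm_2_3_holds_of`, over `takahashi2001_thm_2_3_of_coprime_of_brandtDictionary_one'`. -/
theorem takahashi2001_thm_2_3_of_coprime_holds_of
    (h₁ : takahashi2001_brandtEigenLattice_rank_one_of_coprime)
    (h₂ : takahashi2001_characterGroupDictionary_of_coprime) :
    takahashi2001_thm_2_3_of_coprime := by
  refine takahashi2001_thm_2_3_of_coprime_of_brandtDictionary_one' ?_
  intro W _ M r _ hr hcop hN P hmin hne
  obtain ⟨S₀⟩ := hne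
  classical
  letI : Fintype (Brandt.ClassSet S₀.O) := Fintype.ofFinite _
  obtain ⟨X, pb, pf, hadj, hδ, hsurj, hXsat, hmem⟩ := h₂ W M r hr hcop hN P hmin S₀
  exact ⟨S₀, inferInstance, X, pb, pf, hadj, hδ, hsurj, hXsat, h₁ W M r hr hcop hN P S₀, hmem⟩

/-- **H4** (XS, kernel-checked): the crux BY NAME from H2 and H1, through the landed closer
`definiteRTControlPrime_of_takahashi` (part 7/7 of the one-isogeny re-glue, 2026-09-01). -/
theorem crux_of_leaves
    (h₁ : takahashi2001_brandtEigenLattice_rank_one_of_coprime)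
    (h₂ : takahashi2001_characterGroupDictionary_of_coprime) :
    Summit.ABC.ABC.Theses.DefiniteXi.DefiniteRTControlPrime :=
  Summit.ABC.ABC.Theorems.DefiniteRTControlPrime.definiteRTControlPrime_of_takahashi
    (takahashi2001_thm_2_3_of_coprime_holds_of h₁ h₂)

/-- **Supersession check for the typer (H1/H2 generalise, not duplicate, the square-free pair)**:
at square-free `M r` with `r` prime, `M` is prime to `r`, so the coprime twins specialise to the
square-free level (the minimality hypotheses differ only by the conductor binder, which the
square-free fact's `hmin` implies). Stated for H2, whose hypotheses match literally. -/
theorem rank_one_squarefree_of_coprime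
    (h : takahashi2001_brandtEigenLattice_rank_one_of_coprime) :
    takahashi2001_brandtEigenLattice_rank_one := by
  intro W _ M r _ hr hsq hN P S _
  have hcop : M.Coprime r := by
    rw [Nat.coprime_comm, Nat.Prime.coprime_iff_not_dvd hr]
    rintro ⟨k, rfl⟩
    have : r * r ∣ r * k * r := ⟨k, by ring⟩
    exact hr.ne_one ((Nat.squarefree_iff_prime_squarefree.mp hsq) r hr |> fun h' => absurd this h')
  exact h W M r hr hcop hN P S

/-- Plan A door (verbatim stub shape): inside the skeleton the stub closes only by the fact. -/
theorem stub_of_fact (h : takahashi2001_thm_2_3_of_coprime) : takahashi2001_thm_2_3_of_coprime := h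

end Summit.ABC.ABC.Cruxes.DefiniteRTControlPrime.StubIdeas1G25

end
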